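/-
Copyright: the b2b-balaban cell (near-miss cell 7), T⁴-continuum fan-out, lineage t4-ne7b-p2 (node U5c RENEWAL member).
Released under the licence of the surrounding project.
-/
import Literature.MathematicalPhysics.QuantumFieldTheory.Balaban1983to89.T4EntropyShapeInstances

/-!
# The renewal route's catalogue on the tree's shapes, II: triggered-birth edges and absorption edges

Summits-side support leaf of the T⁴-continuum cell (rung (B)+1 on a FINITE torus only; NOT infinite volume, NOT the
mass gap, NOT the Clay statement; NOT a proof of the spine estimate NE7b).  Lineage `t4-ne7b-p2` (generation 22),
node U5c, RENEWAL route; leaves N3c (triggered-birth ∕ forced-merger edges) and N3d (absorption edges) of the ROUND-2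
skeleton `t4/skeletons/NE7b-t4-ne7b-p2.md`, on the cell's [K] shape theorem
`T4EntropyShapeInstances.birthResidualSum_le` (index model of the operation S).  [folklore] finite sums and real
arithmetic; nothing printed is quoted or asserted; the factors enter as DISPLAYED symbols (`a₂`, `P` = the (1.79)-type
birth exponent of the new region, `S` = the merger surplus of (1.87)-type, `κ₁·Wb` = the tilt raised to the edge's OWN
booking = the new region's window + the extension `n₁ + R`, `cP`∕`cS` = the parts of the credit ∕ surplus the pairing
spends, `N` = the number of contact positions of the structure's zone — cancelled by the prepaid bank of skeleton N2,
`infl` = the resummed partner mass of N5); no `def … : Prop` fact, no `[cite:]` tag of ours.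

WHAT.  §1 `triggerMass_le` (N3c): the children of a parent record at one age that are TRIGGERED BIRTHS are labelled
injectively by (contact position `x` in the zone `Z`, `#Z = N`; face-connected shape `X ∋ x` inside a window `B x`);
with the bank-normalised price `exp(−(a₂(d′+1)) − P)·e^{2μ d′}·(1∕N)·e^{−S}·e^{κ₁·Wb}` and the pairings `κ₁·Wb ≤ cP + cS`,
`cP ≤ P` (small when `cS < S`), rate `κ₀(d) ≤ a₂ − 2μ`: the per-parent sum is `≤ exp(−(S − cS))·K₀(d)` — PARENT-UNIFORM (the `N`
positions cancel against `1∕N`).  §2 `absorptionMass_le` (N3d): absorption children are labelled by the contact position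
only (the joining layers are geometry); price `e^{−S}·infl·(1∕N)·e^{κ₁·Wm}` with `κ₁·Wm ≤ cS` ⇒ per-parent sum
`≤ exp(−(S − cS))·infl`.  §3 `sum_children_le_sigma`: the bookkeeping step «children ↪ labelled pairs» as a lemma.
§4 decided toys.

HONEST DEPENDENCY (cell): continuum YM on T⁴ ⇐ BetaPertH ∧ nine spine estimates (0/9 proved); BetaPertH ⇐ (D1) ∧ (D4)
∧ CAP+tail.  This file changes none of it.
-/

open Finset
open Literature.MathematicalPhysics.QuantumFieldTheory.Balaban1983to89
open Literature.MathematicalPhysics.QuantumFieldTheory.Balaban1983to89.B13ScaleTransfer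
open Literature.MathematicalPhysics.QuantumFieldTheory.Balaban1983to89.TreeLength
open Literature.MathematicalPhysics.QuantumFieldTheory.Balaban1983to89.T4EntropyShapeInstances

namespace Summit.QuantumFields.BalabanUV.T4Continuum.RenewalEdgeMass

noncomputable section

variable {d : ℕ}

/-! ## §3 (stated first, used below) Children injected into a labelled finite catalogue -/

section Inject

variable {ι Lab : Type*} [DecidableEq Lab]

/-- **CHILDREN ↪ LABELS**: an injective labelling of the children `C` into a finite label set `Λs` with prices under a
nonnegative label weight `f` bounds `Σ_C x ≤ Σ_{Λs} f`. [folklore] -/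
theorem sum_children_le_labels (C : Finset ι) (Λs : Finset Lab) (lab : ι → Lab) (x : ι → ℝ) (f : Lab → ℝ)
    (hinj : Set.InjOn lab C) (hmem : ∀ c ∈ C, lab c ∈ Λs) (hf : ∀ l ∈ Λs, 0 ≤ f l) (hx : ∀ c ∈ C, x c ≤ f (lab c)) :
    ∑ c ∈ C, x c ≤ ∑ l ∈ Λs, f l :=
  calc ∑ c ∈ C, x c ≤ ∑ c ∈ C, f (lab c) := Finset.sum_le_sum hx
    _ = ∑ l ∈ C.image lab, f l := (Finset.sum_image hinj).symm
    _ ≤ ∑ l ∈ Λs, f l :=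
        Finset.sum_le_sum_of_subset_of_nonneg (Finset.image_subset_iff.2 hmem) fun l hl _ => hf l hl

end Inject

/-! ## §1 Triggered-birth ∕ forced-merger edges -/

section Trigger

/-- the labelled catalogue of the triggered births: (contact position `x ∈ Z`, face-connected shape `X ∋ x` in the window
`B x`) [folklore] -/
def triggerLabels (Z : Finset (Pt d)) (B : Pt d → Finset (Pt d)) : Finset (Σ _ : Pt d, Finset (Pt d)) := by
  classical
  exact Z.sigma fun x => (B x).powerset.filter fun X => x ∈ X ∧ FaceConnected X

/-- the bank-normalised price of a triggered-birth edge with shape `X`, `N` contact positions [folklore] -/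
def triggerPrice (a₂ μ P S κ₁ Wb : ℝ) (N : ℕ) (X : Finset (Pt d)) : ℝ :=
  Real.exp (-(a₂ * (treeLen X + 1)) - P) * Real.exp (2 * μ * treeLen X) * (1 / (N : ℝ)) * Real.exp (-S) *
    Real.exp (κ₁ * Wb)

/-- the price is nonnegative [folklore] -/
theorem triggerPrice_nonneg (a₂ μ P S κ₁ Wb : ℝ) (N : ℕ) (X : Finset (Pt d)) :
    0 ≤ triggerPrice a₂ μ P S κ₁ Wb N X := by
  unfold triggerPrice; positivity

/-- **N3c — THE TRIGGERED-BIRTH MASS OVER THE LABELLED CATALOGUE IS PARENT-UNIFORM.**  Zone `Z` with `#Z = N > 0`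
contact positions, windows `B x ∋ x`; pairings `κ₁·Wb ≤ cP + cS`, `cP ≤ P` (`cS` = the part paid by the surplus; the bound is useful when `cS < S`); `0 ≤ μ`, rate `κ₀(d) ≤ a₂ − 2μ` ⇒
`Σ_{(x, X) ∈ triggerLabels Z B} triggerPrice … N X ≤ exp(−(S − cS))·K₀(d)`. [folklore] -/
theorem triggerMass_le (Z : Finset (Pt d)) (B : Pt d → Finset (Pt d)) (hB : ∀ x ∈ Z, x ∈ B x) {N : ℕ} (hN : 0 < N)
    (hZN : Z.card ≤ N) {a₂ μ P S κ₁ Wb cP cS : ℝ} (hrate : shapeRate d ≤ a₂ - 2 * μ) (hμ : 0 ≤ μ)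
    (hpair : κ₁ * Wb ≤ cP + cS) (hcP : cP ≤ P) :
    ∑ l ∈ triggerLabels Z B, triggerPrice a₂ μ P S κ₁ Wb N l.2 ≤ Real.exp (-(S - cS)) * shapeConst d := by
  classical
  have hN' : (0 : ℝ) < N := by exact_mod_cast hN
  -- per position: the residual shape sum at rate `a₂ − 2μ`, times `(1/N)·e^{cS − S}`
  have hx : ∀ x ∈ Z, ∑ X ∈ (B x).powerset.filter (fun X => x ∈ X ∧ FaceConnected X), triggerPrice a₂ μ P S κ₁ Wb N X ≤
      (1 / (N : ℝ)) * Real.exp (-(S - cS)) * (Real.exp (-(a₂ - 2 * μ)) * shapeConst d) := by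
    intro x hxZ
    have h1 : ∀ X ∈ (B x).powerset.filter (fun X => x ∈ X ∧ FaceConnected X), triggerPrice a₂ μ P S κ₁ Wb N X ≤
        (1 / (N : ℝ)) * Real.exp (-(S - cS)) * Real.exp (-((a₂ - 2 * μ) * (treeLen X + 1))) := by
      intro X _
      have ht := treeLen_nonneg X
      unfold triggerPrice
      have hexp : Real.exp (-(a₂ * (treeLen X + 1)) - P) * Real.exp (2 * μ * treeLen X) * Real.exp (-S) *
          Real.exp (κ₁ * Wb) ≤ Real.exp (-(S - cS)) * Real.exp (-((a₂ - 2 * μ) * (treeLen X + 1))) := by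
        rw [← Real.exp_add, ← Real.exp_add, ← Real.exp_add, ← Real.exp_add]
        exact Real.exp_le_exp.2 (by nlinarith)
      calc Real.exp (-(a₂ * (treeLen X + 1)) - P) * Real.exp (2 * μ * treeLen X) * (1 / (N : ℝ)) * Real.exp (-S) *
            Real.exp (κ₁ * Wb)
          = (1 / (N : ℝ)) * (Real.exp (-(a₂ * (treeLen X + 1)) - P) * Real.exp (2 * μ * treeLen X) * Real.exp (-S) *
              Real.exp (κ₁ * Wb)) := by ring
        _ ≤ (1 / (N : ℝ)) * (Real.exp (-(S - cS)) * Real.exp (-((a₂ - 2 * μ) * (treeLen X + 1)))) :=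
            mul_le_mul_of_nonneg_left hexp (by positivity)
        _ = (1 / (N : ℝ)) * Real.exp (-(S - cS)) * Real.exp (-((a₂ - 2 * μ) * (treeLen X + 1))) := by ring
    calc ∑ X ∈ (B x).powerset.filter (fun X => x ∈ X ∧ FaceConnected X), triggerPrice a₂ μ P S κ₁ Wb N X
        ≤ ∑ X ∈ (B x).powerset.filter (fun X => x ∈ X ∧ FaceConnected X),
            (1 / (N : ℝ)) * Real.exp (-(S - cS)) * Real.exp (-((a₂ - 2 * μ) * (treeLen X + 1))) := Finset.sum_le_sum h1
      _ = (1 / (N : ℝ)) * Real.exp (-(S - cS)) *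
            ∑ X ∈ (B x).powerset.filter (fun X => x ∈ X ∧ FaceConnected X), Real.exp (-((a₂ - 2 * μ) * (treeLen X + 1))) := by
          rw [Finset.mul_sum]
      _ ≤ (1 / (N : ℝ)) * Real.exp (-(S - cS)) * (Real.exp (-(a₂ - 2 * μ)) * shapeConst d) :=
          mul_le_mul_of_nonneg_left (birthResidualSum_le (B x) (hB x hxZ) hrate) (by positivity)
  -- sum over the `≤ N` positions
  have h0 : 0 ≤ a₂ - 2 * μ := (shapeRate_nonneg d).trans hrate
  have hK : 0 ≤ Real.exp (-(a₂ - 2 * μ)) * shapeConst d := mul_nonneg (Real.exp_pos _).le (shapeConst_pos d).le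
  have hterm : 0 ≤ (1 / (N : ℝ)) * Real.exp (-(S - cS)) * (Real.exp (-(a₂ - 2 * μ)) * shapeConst d) := by positivity
  unfold triggerLabels
  rw [Finset.sum_sigma]
  calc ∑ x ∈ Z, ∑ X ∈ (B x).powerset.filter (fun X => x ∈ X ∧ FaceConnected X), triggerPrice a₂ μ P S κ₁ Wb N X
      ≤ ∑ _x ∈ Z, (1 / (N : ℝ)) * Real.exp (-(S - cS)) * (Real.exp (-(a₂ - 2 * μ)) * shapeConst d) :=
        Finset.sum_le_sum hx
    _ = (Z.card : ℝ) * ((1 / (N : ℝ)) * Real.exp (-(S - cS)) * (Real.exp (-(a₂ - 2 * μ)) * shapeConst d)) := by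
        rw [Finset.sum_const, nsmul_eq_mul]
    _ ≤ (N : ℝ) * ((1 / (N : ℝ)) * Real.exp (-(S - cS)) * (Real.exp (-(a₂ - 2 * μ)) * shapeConst d)) :=
        mul_le_mul_of_nonneg_right (by exact_mod_cast hZN) hterm
    _ = Real.exp (-(S - cS)) * (Real.exp (-(a₂ - 2 * μ)) * shapeConst d) := by field_simp
    _ ≤ Real.exp (-(S - cS)) * (1 * shapeConst d) := by
        refine mul_le_mul_of_nonneg_left ?_ (Real.exp_pos _).le
        exact mul_le_mul_of_nonneg_right (Real.exp_le_one_iff.2 (by linarith)) (shapeConst_pos d).le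
    _ = Real.exp (-(S - cS)) * shapeConst d := by rw [one_mul]

/-- **N3c FOR THE CHILDREN THEMSELVES**: any family of children labelled injectively into `triggerLabels Z B` with prices
under `triggerPrice` of their shape has per-parent sum `≤ exp(−(S − cS))·K₀(d)`. [folklore] -/
theorem triggerChildren_le {ι : Type*} (C : Finset ι) (lab : ι → Σ _ : Pt d, Finset (Pt d)) (x : ι → ℝ)
    (Z : Finset (Pt d)) (B : Pt d → Finset (Pt d)) (hB : ∀ y ∈ Z, y ∈ B y) {N : ℕ} (hN : 0 < N) (hZN : Z.card ≤ N)
    {a₂ μ P S κ₁ Wb cP cS : ℝ} (hrate : shapeRate d ≤ a₂ - 2 * μ) (hμ : 0 ≤ μ)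
    (hpair : κ₁ * Wb ≤ cP + cS) (hcP : cP ≤ P)
    (hinj : Set.InjOn lab C) (hmem : ∀ c ∈ C, lab c ∈ triggerLabels Z B)
    (hx : ∀ c ∈ C, x c ≤ triggerPrice a₂ μ P S κ₁ Wb N (lab c).2) :
    ∑ c ∈ C, x c ≤ Real.exp (-(S - cS)) * shapeConst d := by
  classical
  exact (sum_children_le_labels C (triggerLabels Z B) lab x (fun l => triggerPrice a₂ μ P S κ₁ Wb N l.2) hinj hmem
    (fun l _ => triggerPrice_nonneg _ _ _ _ _ _ _ _) hx).trans (triggerMass_le Z B hB hN hZN hrate hμ hpair hcP)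

end Trigger

/-! ## §2 Absorption edges -/

section Absorption

/-- **N3d — THE ABSORPTION MASS IS PARENT-UNIFORM.**  Contact positions `Z` with `#Z ≤ N`, `0 < N`; price per position
`e^{−S}·infl·(1∕N)·e^{κ₁·Wm}` (surplus, resummed partner mass `infl ≥ 0` of skeleton N5, bank-normalised, tilt raised to
the merger's own booking `Wm = n₁ + R`) with `κ₁·Wm ≤ cS` ⇒ `Σ_Z … ≤ exp(−(S − cS))·infl`. [folklore] -/
theorem absorptionMass_le (Z : Finset (Pt d)) {N : ℕ} (hN : 0 < N) (hZN : Z.card ≤ N) {S κ₁ Wm cS infl : ℝ}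
    (hinfl : 0 ≤ infl) (hpair : κ₁ * Wm ≤ cS) :
    ∑ _x ∈ Z, Real.exp (-S) * infl * (1 / (N : ℝ)) * Real.exp (κ₁ * Wm) ≤ Real.exp (-(S - cS)) * infl := by
  have hN' : (0 : ℝ) < N := by exact_mod_cast hN
  have h1 : Real.exp (-S) * Real.exp (κ₁ * Wm) ≤ Real.exp (-(S - cS)) := by
    rw [← Real.exp_add]; exact Real.exp_le_exp.2 (by linarith)
  have hterm : 0 ≤ Real.exp (-S) * infl * (1 / (N : ℝ)) * Real.exp (κ₁ * Wm) := by positivity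
  rw [Finset.sum_const, nsmul_eq_mul]
  calc (Z.card : ℝ) * (Real.exp (-S) * infl * (1 / (N : ℝ)) * Real.exp (κ₁ * Wm))
      ≤ (N : ℝ) * (Real.exp (-S) * infl * (1 / (N : ℝ)) * Real.exp (κ₁ * Wm)) :=
        mul_le_mul_of_nonneg_right (by exact_mod_cast hZN) hterm
    _ = (Real.exp (-S) * Real.exp (κ₁ * Wm)) * infl := by field_simp
    _ ≤ Real.exp (-(S - cS)) * infl := mul_le_mul_of_nonneg_right h1 hinfl

/-- **N3d FOR THE CHILDREN THEMSELVES**: absorption children labelled injectively by their contact position, prices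
under the per-position price ⇒ per-parent sum `≤ exp(−(S − cS))·infl`. [folklore] -/
theorem absorptionChildren_le {ι : Type*} (C : Finset ι) (pos : ι → Pt d) (x : ι → ℝ) (Z : Finset (Pt d)) {N : ℕ}
    (hN : 0 < N) (hZN : Z.card ≤ N) {S κ₁ Wm cS infl : ℝ} (hinfl : 0 ≤ infl) (hpair : κ₁ * Wm ≤ cS)
    (hinj : Set.InjOn pos C) (hmem : ∀ c ∈ C, pos c ∈ Z)
    (hx : ∀ c ∈ C, x c ≤ Real.exp (-S) * infl * (1 / (N : ℝ)) * Real.exp (κ₁ * Wm)) :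
    ∑ c ∈ C, x c ≤ Real.exp (-(S - cS)) * infl :=
  (sum_children_le_labels C Z pos x (fun _ => Real.exp (-S) * infl * (1 / (N : ℝ)) * Real.exp (κ₁ * Wm)) hinj hmem
    (fun _ _ => by positivity) hx).trans (absorptionMass_le Z hN hZN hinfl hpair)

end Absorption

/-! ## §4 Decided toys -/

section Toy

/-- the absorption edge on numbers: `3` contact positions, `N = 3`, `S = 10`, `cS = 4 = κ₁·Wm` (`κ₁ = 1`, `Wm = 4`),
`infl = 5`: mass `≤ e^{−6}·5` -/
example : ∑ _x ∈ ({(fun _ => 0), (fun _ => 1), (fun _ => 2)} : Finset (Pt 1)),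
      Real.exp (-10) * 5 * (1 / ((3 : ℕ) : ℝ)) * Real.exp (1 * 4) ≤ Real.exp (-(10 - 4)) * 5 :=
  absorptionMass_le _ (by norm_num) (Finset.card_le_three) (by norm_num) (by norm_num)

/-- the exponent bookkeeping of the trigger edge on numbers (`a₂ = 10`, `μ = 2`, `P = 5`, `S = 7`, `cP = 3`, `cS = 2`,
`κ₁ Wb = 5 ≤ cP + cS`, tree length `1`): `−20 − 5 + 4 − 7 + 5 = −23 ≤ −(7 − 2) − 6·2 = −17` -/
example : (-(10 * ((1 : ℚ) + 1)) - 5) + 2 * 2 * 1 - 7 + 5 ≤ -(7 - 2) - (10 - 2 * 2) * (1 + 1) := by norm_num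

end Toy

end

end Summit.QuantumFields.BalabanUV.T4Continuum.RenewalEdgeMass
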